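import Mathlib
import Summits.RiemannHypothesis.RiemannHypothesis.Theorems.JensenPolynomialsDefs
import Summits.RiemannHypothesis.RiemannHypothesis.Theorems.JensenHermiteSignTest
import Literature.NumberTheory.LFunctions.XiMoments

/-! # JensenTuranEnergyTable — S-H3, first table: the Turán-energy critical-ratio table `rhoHT` is admissible,
`hermiteCriticalRatioBound_turan : HermiteCriticalRatioBound rhoHT` (rows `j ≤ 4` explicit, energy rows
`√((d−j)!/(2^j (d−1)!))` from Turán's identity `D_m = G_{m+1}² − G_m G_{m+2} = 2·m!·Σ_i G_i²/i!`).  RH-FREE, ξ-free (Hermite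
polynomials only).  Verbatim port of HOME `rh-jensen-theory/JensenTargets.lean` v4.6 §8.8 (cell rh-jensen, HUMAN RULING D-0040; one
file per source section, D-0064(4)); supports the route item `JensenPolynomials.HermiteCriticalRatioWindow` (rows `j ≤ 4` and the
energy rows of the route's table `rhoWinMin` ARE `rhoHT`).  Nothing here bears on the zeros of `ζ`. -/

noncomputable section
set_option linter.dupNamespace false

open Polynomial Finset
open scoped Nat

namespace Summit.RiemannHypothesis.RiemannHypothesis.Theorems.JensenPolynomials

open Literature.NumberTheory.LFunctions


/-! Turán's determinant for the tree's Hermite polynomials is written out as `D_m := G_{m+1}² − G_m·G_{m+2}`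
(`G_k = gorzHermite k = H_k(X/2)`) everywhere below (no auxiliary definition). -/

/-- `D_0 = 2`. -/
theorem gorzTuranDet_zero : gorzHermite 1 ^ 2 - gorzHermite 0 * gorzHermite 2 = C (2 : ℝ) := by
  rw [gorzHermite_two, gorzHermite_one, gorzHermite_zero]; ring

/-- The Turán recurrence `D_{m+1} = 2(m+1)·D_m + 2·G_{m+1}²` (from the three-term recurrence; it
integrates to the classical identity `D_m = 2^{m+1} m! Σ_{i≤m} G_i²/(2^i i!)`). -/
theorem gorzTuranDet_succ (m : ℕ) :
    gorzHermite (m + 1 + 1) ^ 2 - gorzHermite (m + 1) * gorzHermite (m + 1 + 2) =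
      C (2 * ((m : ℝ) + 1)) * (gorzHermite (m + 1) ^ 2 - gorzHermite m * gorzHermite (m + 2)) +
        C 2 * gorzHermite (m + 1) ^ 2 := by
  have h3 : gorzHermite (m + 3) = X * gorzHermite (m + 2) - C (2 * ((m : ℝ) + 2)) * gorzHermite (m + 1) := by
    have := gorzHermite_add_two (m + 1)
    rw [show m + 1 + 2 = m + 3 from rfl, show m + 1 + 1 = m + 2 from rfl] at this
    rw [this]; push_cast; ring
  have h2 := gorzHermite_add_two m
  have hC : (C (2 * ((m : ℝ) + 2)) : ℝ[X]) = C (2 * ((m : ℝ) + 1)) + C 2 := by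
    rw [← C_add]; congr 1; ring
  rw [show m + 1 + 1 = m + 2 from rfl, show m + 1 + 2 = m + 3 from rfl, h3, hC, h2]
  ring

/-- **Turán energy inequality**: `2^{m+1−i}·(m!/i!)·G_i(x)² ≤ D_m(x)` for `i ≤ m` (each term of the
classical sum is dominated by the determinant). -/
theorem gorzHermite_sq_le_turanDet (m : ℕ) : ∀ i ≤ m, ∀ x : ℝ,
    2 ^ (m + 1 - i) * ((m ! : ℝ) / (i ! : ℝ)) * ((gorzHermite i).eval x) ^ 2 ≤ (gorzHermite (m + 1) ^ 2 - gorzHermite m * gorzHermite (m + 2)).eval x := by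
  induction m with
  | zero =>
    intro i hi x
    obtain rfl : i = 0 := by omega
    have h0 := congrArg (Polynomial.eval x) gorzTuranDet_zero
    simp only [eval_C] at h0
    simp only [Nat.reduceAdd, h0]
    norm_num
  | succ m ih =>
    intro i hi x
    have hD : 0 ≤ (gorzHermite (m + 1) ^ 2 - gorzHermite m * gorzHermite (m + 2)).eval x :=
      le_trans (by positivity) (ih 0 (Nat.zero_le _) x)
    rw [gorzTuranDet_succ, eval_add, eval_mul, eval_C, eval_mul, eval_C, eval_pow]
    rcases Nat.lt_or_ge i (m + 1) with hlt | hge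
    · have hi' := ih i (by omega) x
      have hsq : 0 ≤ ((gorzHermite (m + 1)).eval x) ^ 2 := sq_nonneg _
      calc 2 ^ (m + 1 + 1 - i) * (((m + 1)! : ℝ) / (i ! : ℝ)) * ((gorzHermite i).eval x) ^ 2
          = 2 * ((m : ℝ) + 1) * (2 ^ (m + 1 - i) * ((m ! : ℝ) / (i ! : ℝ)) * ((gorzHermite i).eval x) ^ 2) := by
            rw [show m + 1 + 1 - i = (m + 1 - i) + 1 by omega, pow_succ, Nat.factorial_succ]; push_cast; ring
        _ ≤ 2 * ((m : ℝ) + 1) * (gorzHermite (m + 1) ^ 2 - gorzHermite m * gorzHermite (m + 2)).eval x := by gcongr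
        _ ≤ 2 * ((m : ℝ) + 1) * (gorzHermite (m + 1) ^ 2 - gorzHermite m * gorzHermite (m + 2)).eval x + 2 * ((gorzHermite (m + 1)).eval x) ^ 2 := by
            linarith
    · obtain rfl : i = m + 1 := by omega
      rw [show m + 1 + 1 - (m + 1) = 1 by omega, pow_one, div_self (by positivity), mul_one]
      nlinarith [hD, sq_nonneg ((gorzHermite (m + 1)).eval x)]

/-- **Critical-ratio bound from the Turán energy**: at a zero `y` of `G_{d−1}`,
`|G_{d−j}(y)| ≤ √((d−j)!/(2^j (d−1)!))·|G_d(y)|` for `2 ≤ j ≤ d`. -/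
theorem hermiteCriticalRatio_turan {d j : ℕ} (hj : 2 ≤ j) (hjd : j ≤ d) {y : ℝ}
    (hy : (gorzHermite (d - 1)).eval y = 0) :
    |(gorzHermite (d - j)).eval y| ≤
      Real.sqrt (((d - j)! : ℝ) / (2 ^ j * ((d - 1)! : ℝ))) * |(gorzHermite d).eval y| := by
  obtain ⟨m, rfl⟩ : ∃ m, d = m + 2 := ⟨d - 2, by omega⟩
  rw [show m + 2 - 1 = m + 1 by omega] at hy ⊢
  set i := m + 2 - j with hi
  have him : i ≤ m := by omega
  have hG2 : (gorzHermite (m + 2)).eval y = -(2 * ((m : ℝ) + 1)) * (gorzHermite m).eval y := by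
    rw [gorzHermite_add_two, eval_sub, eval_mul, eval_X, hy, mul_zero, zero_sub, eval_mul, eval_C]
    ring
  have hDm : (gorzHermite (m + 1) ^ 2 - gorzHermite m * gorzHermite (m + 2)).eval y = ((gorzHermite (m + 2)).eval y) ^ 2 / (2 * ((m : ℝ) + 1)) := by
    rw [eval_sub, eval_pow, hy, eval_mul, hG2]
    field_simp
    ring
  have key := gorzHermite_sq_le_turanDet m i him y
  rw [hDm, le_div_iff₀ (by positivity)] at key
  have hfi : (0 : ℝ) < i ! := by positivity
  have hsq : ((gorzHermite i).eval y) ^ 2 ≤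
      ((i ! : ℝ) / (2 ^ j * ((m + 1)! : ℝ))) * ((gorzHermite (m + 2)).eval y) ^ 2 := by
    rw [show j = (m + 1 - i) + 1 by omega, pow_succ, Nat.factorial_succ]
    push_cast
    rw [div_mul_eq_mul_div, le_div_iff₀ (by positivity)]
    calc ((gorzHermite i).eval y) ^ 2 * (2 ^ (m + 1 - i) * 2 * (((m : ℝ) + 1) * (m ! : ℝ)))
        = (2 ^ (m + 1 - i) * ((m ! : ℝ) / (i ! : ℝ)) * ((gorzHermite i).eval y) ^ 2 *
            (2 * ((m : ℝ) + 1))) * (i ! : ℝ) := by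
          field_simp
      _ ≤ ((gorzHermite (m + 2)).eval y) ^ 2 * (i ! : ℝ) := by gcongr
      _ = (i ! : ℝ) * ((gorzHermite (m + 2)).eval y) ^ 2 := mul_comm _ _
  have hcoef : 0 ≤ (i ! : ℝ) / (2 ^ j * ((m + 1)! : ℝ)) := by positivity
  calc |(gorzHermite i).eval y| = Real.sqrt (((gorzHermite i).eval y) ^ 2) := (Real.sqrt_sq_eq_abs _).symm
    _ ≤ Real.sqrt (((i ! : ℝ) / (2 ^ j * ((m + 1)! : ℝ))) * ((gorzHermite (m + 2)).eval y) ^ 2) :=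
        Real.sqrt_le_sqrt hsq
    _ = Real.sqrt ((i ! : ℝ) / (2 ^ j * ((m + 1)! : ℝ))) * |(gorzHermite (m + 2)).eval y| := by
        rw [Real.sqrt_mul hcoef, Real.sqrt_sq_eq_abs]

/-- **S-H3 instance PROVED (ξ-free, RH-FREE, every `d`)**: `HermiteCriticalRatioBound ρ_HT` — the first
PROVED critical-ratio table. Rows `j ≤ 4` are the exact three-term-recurrence ratios at a critical point
bounded through the zero bound S-H1 (`hermiteZeroBound_holds`); rows `j ≥ 5` are the Turán-energy bound
`hermiteCriticalRatio_turan`. `#print axioms`: `[propext, Classical.choice, Quot.sound]`. -/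
theorem hermiteCriticalRatioBound_turan : HermiteCriticalRatioBound rhoHT := by
  intro d j y hj1 hjd hy
  unfold rhoHT
  rcases (by omega : j = 1 ∨ j = 2 ∨ j = 3 ∨ j = 4 ∨ 5 ≤ j) with rfl | rfl | rfl | rfl | hj5
  · rw [if_pos le_rfl, hy, abs_zero, zero_mul]
  · rw [if_neg (by omega), if_pos rfl]
    obtain ⟨m, rfl⟩ : ∃ m, d = m + 2 := ⟨d - 2, by omega⟩
    rw [show m + 2 - 1 = m + 1 by omega] at hy
    rw [show m + 2 - 2 = m by omega]
    have hG2 : (gorzHermite (m + 2)).eval y = -(2 * ((m : ℝ) + 1)) * (gorzHermite m).eval y := by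
      rw [gorzHermite_add_two, eval_sub, eval_mul, eval_X, hy, mul_zero, zero_sub, eval_mul, eval_C]
      ring
    rw [hG2, abs_mul, abs_neg, abs_of_pos (by positivity : (0 : ℝ) < 2 * ((m : ℝ) + 1))]
    push_cast
    rw [show (m : ℝ) + 2 - 1 = (m : ℝ) + 1 by ring]
    have hm1 : (2 * ((m : ℝ) + 1)) ≠ 0 := by positivity
    have : 1 / (2 * ((m : ℝ) + 1)) * (2 * ((m : ℝ) + 1) * |(gorzHermite m).eval y|) =
        |(gorzHermite m).eval y| := by
      field_simp
    rw [this]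
  · rw [if_neg (by omega), if_neg (by omega), if_pos rfl]
    obtain ⟨m, rfl⟩ : ∃ m, d = m + 3 := ⟨d - 3, by omega⟩
    rw [show m + 3 - 1 = m + 2 by omega] at hy
    rw [show m + 3 - 3 = m by omega]
    -- G_{m+2}(y) = 0 ⇒ G_{m+3}(y) = −2(m+2)·G_{m+1}(y) and y·G_{m+1}(y) = 2(m+1)·G_m(y)
    have hG3 : (gorzHermite (m + 3)).eval y = -(2 * ((m : ℝ) + 2)) * (gorzHermite (m + 1)).eval y := by
      have := gorzHermite_add_two (m + 1)
      rw [show m + 1 + 2 = m + 3 from rfl, show m + 1 + 1 = m + 2 from rfl] at this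
      rw [this, eval_sub, eval_mul, eval_X, hy, mul_zero, zero_sub, eval_mul, eval_C]
      push_cast; ring
    have hGm : y * (gorzHermite (m + 1)).eval y = 2 * ((m : ℝ) + 1) * (gorzHermite m).eval y := by
      have := gorzHermite_add_two m
      have h0 : (gorzHermite (m + 2)).eval y = y * (gorzHermite (m + 1)).eval y -
          2 * ((m : ℝ) + 1) * (gorzHermite m).eval y := by
        rw [this, eval_sub, eval_mul, eval_X, eval_mul, eval_C]
      rw [hy] at h0
      linarith
    have hy_bd : |y| < 2 * Real.sqrt (2 * ((m : ℝ) + 2) + 1) := by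
      have := hermiteZeroBound_holds (m + 2) y hy
      push_cast at this
      exact this
    have hsq : Real.sqrt (2 * ((m : ℝ) + 3) - 1) = Real.sqrt (2 * ((m : ℝ) + 2) + 1) := by
      congr 1; ring
    push_cast
    rw [hsq, hG3, abs_mul, abs_neg, abs_of_pos (by positivity : (0 : ℝ) < 2 * ((m : ℝ) + 2)),
      show (m : ℝ) + 3 - 1 = (m : ℝ) + 2 by ring, show (m : ℝ) + 3 - 2 = (m : ℝ) + 1 by ring]
    -- |G_m| = |y|·|G_{m+1}|/(2(m+1)) ≤ 2√(2m+5)/(2(m+1)) · |G_{m+1}|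
    have hm1 : (0 : ℝ) < 2 * ((m : ℝ) + 1) := by positivity
    have h1 : |y| * |(gorzHermite (m + 1)).eval y| = 2 * ((m : ℝ) + 1) * |(gorzHermite m).eval y| := by
      rw [← abs_mul, hGm, abs_mul, abs_of_pos hm1]
    have habs : |(gorzHermite m).eval y| = |y| * |(gorzHermite (m + 1)).eval y| / (2 * ((m : ℝ) + 1)) := by
      rw [h1]; field_simp
    rw [habs, div_le_iff₀ hm1]
    have hG1 : 0 ≤ |(gorzHermite (m + 1)).eval y| := abs_nonneg _
    have hm2 : (2 * ((m : ℝ) + 2) * ((m : ℝ) + 1)) ≠ 0 := by positivity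
    calc |y| * |(gorzHermite (m + 1)).eval y|
        ≤ (2 * Real.sqrt (2 * ((m : ℝ) + 2) + 1)) * |(gorzHermite (m + 1)).eval y| := by gcongr
      _ = Real.sqrt (2 * ((m : ℝ) + 2) + 1) / (2 * ((m : ℝ) + 2) * ((m : ℝ) + 1)) *
            (2 * ((m : ℝ) + 2) * |(gorzHermite (m + 1)).eval y|) * (2 * ((m : ℝ) + 1)) := by
          field_simp
  · rw [if_neg (by omega), if_neg (by omega), if_neg (by omega), if_pos rfl]
    obtain ⟨m, rfl⟩ : ∃ m, d = m + 4 := ⟨d - 4, by omega⟩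
    rw [show m + 4 - 1 = m + 3 by omega] at hy
    rw [show m + 4 - 4 = m by omega]
    have hG4 : (gorzHermite (m + 4)).eval y = -(2 * ((m : ℝ) + 3)) * (gorzHermite (m + 2)).eval y := by
      have := gorzHermite_add_two (m + 2)
      rw [show m + 2 + 2 = m + 4 from rfl, show m + 2 + 1 = m + 3 from rfl] at this
      rw [this, eval_sub, eval_mul, eval_X, hy, mul_zero, zero_sub, eval_mul, eval_C]
      push_cast; ring
    have hG3 : y * (gorzHermite (m + 2)).eval y = 2 * ((m : ℝ) + 2) * (gorzHermite (m + 1)).eval y := by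
      have := gorzHermite_add_two (m + 1)
      rw [show m + 1 + 2 = m + 3 from rfl, show m + 1 + 1 = m + 2 from rfl] at this
      have h0 : (gorzHermite (m + 3)).eval y = y * (gorzHermite (m + 2)).eval y -
          2 * ((m : ℝ) + 2) * (gorzHermite (m + 1)).eval y := by
        rw [this, eval_sub, eval_mul, eval_X, eval_mul, eval_C]; push_cast; ring
      rw [hy] at h0
      linarith
    have hG2 : (gorzHermite (m + 2)).eval y = y * (gorzHermite (m + 1)).eval y -
        2 * ((m : ℝ) + 1) * (gorzHermite m).eval y := by
      rw [gorzHermite_add_two, eval_sub, eval_mul, eval_X, eval_mul, eval_C]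
    have hGm : 4 * ((m : ℝ) + 1) * ((m : ℝ) + 2) * (gorzHermite m).eval y =
        (y ^ 2 - 2 * ((m : ℝ) + 2)) * (gorzHermite (m + 2)).eval y := by
      linear_combination (2 * ((m : ℝ) + 2)) * hG2 + (-y) * hG3
    have hy_bd : |y| < 2 * Real.sqrt (2 * ((m : ℝ) + 3) + 1) := by
      have := hermiteZeroBound_holds (m + 3) y hy
      push_cast at this
      exact this
    have hy2 : y ^ 2 < 4 * (2 * ((m : ℝ) + 3) + 1) := by
      have h0 : 0 ≤ 2 * Real.sqrt (2 * ((m : ℝ) + 3) + 1) := by positivity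
      have h1 : |y| ^ 2 < (2 * Real.sqrt (2 * ((m : ℝ) + 3) + 1)) ^ 2 :=
        pow_lt_pow_left₀ hy_bd (abs_nonneg _) two_ne_zero
      rw [sq_abs, mul_pow, Real.sq_sqrt (by positivity)] at h1
      linarith
    have hnum : |y ^ 2 - 2 * ((m : ℝ) + 2)| ≤ 6 * ((m : ℝ) + 4) := by
      rw [abs_le]; constructor <;> nlinarith [sq_nonneg y]
    push_cast
    rw [show (m : ℝ) + 4 - 1 = (m : ℝ) + 3 by ring, show (m : ℝ) + 4 - 2 = (m : ℝ) + 2 by ring,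
      show (m : ℝ) + 4 - 3 = (m : ℝ) + 1 by ring, hG4, abs_mul, abs_neg,
      abs_of_pos (by positivity : (0 : ℝ) < 2 * ((m : ℝ) + 3))]
    have hm12 : (0 : ℝ) < 4 * ((m : ℝ) + 1) * ((m : ℝ) + 2) := by positivity
    have habs : |(gorzHermite m).eval y| =
        |y ^ 2 - 2 * ((m : ℝ) + 2)| * |(gorzHermite (m + 2)).eval y| / (4 * ((m : ℝ) + 1) * ((m : ℝ) + 2)) := by
      rw [eq_div_iff hm12.ne', ← abs_mul, ← hGm, abs_mul, abs_of_pos hm12]; ring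
    rw [habs, div_le_iff₀ hm12]
    have hG1 : 0 ≤ |(gorzHermite (m + 2)).eval y| := abs_nonneg _
    have hm3 : (4 * ((m : ℝ) + 3) * ((m : ℝ) + 2) * ((m : ℝ) + 1)) ≠ 0 := by positivity
    calc |y ^ 2 - 2 * ((m : ℝ) + 2)| * |(gorzHermite (m + 2)).eval y|
        ≤ (6 * ((m : ℝ) + 4)) * |(gorzHermite (m + 2)).eval y| := by gcongr
      _ = 3 * ((m : ℝ) + 4) / (4 * ((m : ℝ) + 3) * ((m : ℝ) + 2) * ((m : ℝ) + 1)) *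
            (2 * ((m : ℝ) + 3) * |(gorzHermite (m + 2)).eval y|) * (4 * ((m : ℝ) + 1) * ((m : ℝ) + 2)) := by
          field_simp
          ring
  · rw [if_neg (by omega), if_neg (by omega), if_neg (by omega), if_neg (by omega)]
    exact hermiteCriticalRatio_turan (by omega) hjd hy
end Summit.RiemannHypothesis.RiemannHypothesis.Theorems.JensenPolynomials

end
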